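/-
Copyright (c) 2026. All rights reserved.
Released under Apache 2.0 license as described in the file LICENSE.
-/
import Summits.NavierStokesRegularity.FluidComputer.RowCircuitRobust
import Summits.NavierStokesRegularity.FluidComputer.RowCircuitReentry
import HarnessLib

/-!
# The scale-induction step under uniform forcing (class `U`), up to the re-entry certificate

HONEST FRAMING (cell `pub-fluidc`, blueprint seat bp3, gen 23): low prior, high value-of-information
experiment on Tao's machine paradigm; NOT a claim that NS blows up. 9-mode TOY chain only; the
forcing class `U` (`|δF_a(σ)| ≤ δUQ a`: `2⁻¹⁹` on the first gate's modes, `2⁻²⁹` on the second's,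
`RowChainForceQ`) is the INTERFACE slot for everything the true coupling adds to the toy window
(back-reaction of discarded modes, truncation, model error) — whether true Navier–Stokes dynamics
near the designed states stays inside class `U` is NOT proved anywhere (ASSEMBLY.md, gen 23).

* `forced_section_from` — every solution of the forced circuit `y' = F(y) + δF`, `δF ∈ U`
  continuous, started in row `0`'s start tube box with the lock value, reaches at a time
  `|τ − 19/20| ≤ 3/500` a section state `b₂ = ρ a₂` with level `ℓ' ∈ [levLo, levHi]` and read-outs
  in the induction box B' (`secCert`): the class-`U` twin of `circuit_section_from` (same 1066
  certified enclosures — their defect budgets `DEL` dominate `δUQ`, `force_budgetQ`).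
* `forced_induction_step_of` — with the re-entry certificate as hypothesis (TRUE on the gen-23
  chain k54b, FALSE on k53d; see `RowCircuitReentry`): the re-entry box is mapped into itself by
  "forced flow to the section + renormalise + quiet fresh modes", for EVERY forcing of class `U`
  and every solution (existence: `CircuitFlow.forced_solution`, cf. `robust_transfer`).

COMPUTATIONAL (chain cone, `Lean.ofReduceBool`). No `sorry`, no new axioms.
-/

namespace Summit.NavierStokesRegularity.FluidComputer

open Literature.Analysis.FluidPDE.FluidComputer

namespace RowChain

open RowCheck RowCheck.RowData RowRun ChainField Set

/-- **Forced circuit to the section (class `U`).** [folklore] -/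
theorem forced_section_from {q₀ : Fin 9 → ℝ} (hlock : q₀ (row 0).p = X0 (row 0).p)
    (hbox : ∀ i, |z0 q₀ i| ≤ (row 0).ubR 0 i) {y δF : ℝ → Fin 9 → ℝ} (hy0 : y 0 = q₀)
    (hsol : ∀ σ, HasDerivAt y (F gK ΛK (y σ) + δF σ) σ) (hδc : Continuous δF)
    (hδ : ∀ σ a, |δF σ a| ≤ (δUQ a : ℝ)) :
    ∃ τ : ℝ,
      |τ - 19 / 20| ≤ 3 / 500 ∧
      y τ 5 = (secCert.rho : ℝ) * y τ 4 ∧ 0 < y τ 4 ∧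
      ((secCert.levLo : ℝ) ≤ y τ 5 / secCert.bmid ∧ y τ 5 / secCert.bmid ≤ secCert.levHi) ∧
      ∀ j : Fin 3, |(secCert.bmid : ℝ) * y τ (rdIdx j) / y τ 5 - secCert.ctr j| ≤
        secCert.wid j := by
  have hyc : Continuous y := continuous_iff_continuousAt.2 fun σ => (hsol σ).continuousAt
  obtain ⟨sA, sdA, sB, sdB, sD, sdD, hs0, hmem, ⟨S1⟩, ⟨S2⟩⟩ := chain_members Tc Tc_succ (y := y)
    (δF := δF) (D := univ) isOpen_univ
    (fun σ _ a => by simpa using (hasDerivAt_pi.1 (hsol σ)) a)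
    (fun k _ => by
      have hc : Continuous fun σ => F gK ΛK (y σ) (row k).p + δF σ (row k).p :=
        ((continuous_apply (row k).p).comp ((continuous_F gK ΛK).comp hyc)).add
          ((continuous_apply (row k).p).comp hδc)
      exact hc.continuousOn)
    (fun k hk σ _ t _ _ a => (hδ σ a).trans (δU_le_δR k hk a))
    (fun K _ _ => subset_univ _)
    (fun σ _ _ => ⟨subset_univ _, fun ξ _ a => (hδ ξ a).trans (δU_le_win 656 657 (by norm_num) a)⟩)
    (fun σ _ _ => ⟨subset_univ _, fun ξ _ a => (hδ ξ a).trans (δU_le_win 986 987 (by norm_num) a)⟩)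
    (σ₀ := 0) (mem_univ _) (by rw [hy0, hlock]; rfl)
    (fun i => by
      rw [z_start_eq_z0 (Tc 0) y δF univ (fun _ => 0) (fun _ => 0) rfl hy0]
      exact hbox i)
  have hu0A : ∀ i, |(toModel (canon (framesOK_row 0)) (G 0) (Tc 0) ⟨y, δF, univ, sA, sdA⟩).z
      (Tc 0) i| ≤ (row 0).ubR 0 i := fun i => by
    rw [z_start_eq_z0 (Tc 0) y δF univ sA sdA hs0 hy0]
    exact hbox i
  have h := segAD Tc Tc_succ ⟨y, δF, univ, sA, sdA⟩ ⟨y, δF, univ, sB, sdB⟩ ⟨y, δF, univ, sD, sdD⟩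
    (fun k hk => (hmem k hk).some) hu0A S1 S2
  -- the chain's clock up to the end of the last row
  have hrow : ∀ k < 1066, |(mOf ⟨y, δF, univ, sA, sdA⟩ ⟨y, δF, univ, sB, sdB⟩ ⟨y, δF, univ, sD, sdD⟩
      k).s (Tc (k + 1)) - (mOf ⟨y, δF, univ, sA, sdA⟩ ⟨y, δF, univ, sB, sdB⟩ ⟨y, δF, univ, sD, sdD⟩
      k).s (Tc k) - (row k).Hq| ≤ (row k).rhoR * (row k).Hq := by
    intro k hk
    have hH : Tc (k + 1) - Tc k = (row k).Hq := by rw [Tc_succ k]; ring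
    have hle : Tc k ≤ Tc (k + 1) := by
      have := Hq_pos ((runOK_iff _).mp (runOK_row k)).1
      linarith
    have h1 := row_time (hmem k hk).some hle (h k hk).2.2.2
    change |(mOf _ _ _ k).s (Tc (k + 1)) - (mOf _ _ _ k).s (Tc k) - (Tc (k + 1) - Tc k)| ≤
      (row k).rhoR * (Tc (k + 1) - Tc k) at h1
    rw [hH] at h1
    exact h1
  have hclock := chain_time Tc (fun k => ((row k).Hq : ℝ)) (fun k => (row k).rhoR) Tc_succ sA sB
    sD hs0 (fun k hk => by have := hrow k (by omega); rwa [mOf_A hk] at this)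
    (fun k hk hk' => by have := hrow k (by omega); rwa [mOf_B hk hk'] at this)
    (fun k hk hk' => by have := hrow k hk'; rwa [mOf_D hk] at this) S1.hσ S2.hσ
  rw [Tc_zero] at hclock
  -- the member on the window rows (segment D): continuity, tubes, per-row time
  set v : ℝ → Fin 9 → ℝ := fun t => y (sD t) with hv
  have hcont : ∀ k, 987 ≤ k → k < 1066 → ContinuousOn v (Icc (Tc k) (Tc (k + 1))) := by
    intro k hk1 hk2
    have hm := (hmem k hk2).some
    rw [mOf_D hk1] at hm
    have hsc := hm.hsc
    change ContinuousOn sD (Icc (Tc k) (Tc (k + 1))) at hsc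
    exact hyc.comp_continuousOn hsc
  have htube : ∀ k, 987 ≤ k → k < 1066 → ∀ t ∈ Icc (Tc k) (Tc (k + 1)), ∀ a,
      |v t a - xh (row k).CQ (t - Tc k) a| ≤ (row k).EbarR a := by
    intro k hk1 hk2 t ht a
    have h1 := (h k hk2).2.1 t ht a
    rw [mOf_D hk1] at h1
    exact h1
  have htime : ∀ k, 987 ≤ k → k < 1066 → ∀ t ∈ Icc (Tc k) (Tc (k + 1)),
      |sD t - sD (Tc k) - (t - Tc k)| ≤ (row k).rhoR * (row k).Hq := by
    intro k hk1 hk2 t ht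
    have hm := (hmem k hk2).some
    have hrate := (h k hk2).2.2.2
    rw [mOf_D hk1] at hm hrate
    have h1 := row_time_at hm hrate (t := t) ht
    change |sD t - sD (Tc k) - (t - Tc k)| ≤ (row k).rhoR * (t - Tc k) at h1
    have hρ : 0 ≤ (row k).rhoR := by
      have := hrate (Tc k) ⟨le_rfl, by
        have := Hq_pos ((runOK_iff _).mp (runOK_row k)).1
        rw [Tc_succ k]; linarith⟩
      exact (abs_nonneg _).trans this
    have hH : t - Tc k ≤ (row k).Hq := by rw [Tc_succ k] at ht; linarith [ht.2]
    exact h1.trans (mul_le_mul_of_nonneg_left hH hρ)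
  -- the section read-out
  obtain ⟨t, ht, hsec, hpos, hlev, hrat⟩ := section_sound section_cert (v := v) (Tc_succ 1064)
    (Tc_succ 1065) (hcont 1064 (by norm_num) (by norm_num)) (hcont 1065 (by norm_num) (by norm_num))
    (htube 1064 (by norm_num) (by norm_num)) (htube 1065 (by norm_num) (by norm_num))
  refine ⟨sD t, ?_, hsec, hpos, hlev, hrat⟩
  -- the clock at the crossing
  obtain ⟨hS, hO, h19⟩ := time_budgetQ
  have hS' : ((∑ k ∈ Finset.range 1066, ((row k).ph'.rho : ℚ) / 2 ^ (row k).P * (row k).Hq : ℚ)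
      : ℝ) ≤ ((1 / 600 : ℚ) : ℝ) := by exact_mod_cast hS
  have hO' : (((cert656.Ds : ℚ) / 2 ^ (row 657).P + (cert986.Ds : ℚ) / 2 ^ (row 987).P : ℚ) : ℝ)
      ≤ ((1 / 700 : ℚ) : ℝ) := by exact_mod_cast hO
  have h19' : ((|∑ k ∈ Finset.range 1066, (row k).Hq - 19 / 20| : ℚ) : ℝ) ≤ ((1 / 1000 : ℚ) : ℝ) :=
    by exact_mod_cast h19
  have hw' := windowQ
  have hw : (((row 1064).Hq + (row 1065).Hq +
      3 * (((row 1064).ph'.rho : ℚ) / 2 ^ (row 1064).P * (row 1064).Hq) +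
      3 * (((row 1065).ph'.rho : ℚ) / 2 ^ (row 1065).P * (row 1065).Hq) : ℚ) : ℝ) ≤
      ((11 / 10000 : ℚ) : ℝ) := by exact_mod_cast hw'
  push_cast at hS' hO' h19' hw
  have hsum : ∑ k ∈ Finset.range 1066, (row k).rhoR * (row k).Hq =
      ∑ k ∈ Finset.range 1066, ((row k).ph'.rho : ℝ) / 2 ^ (row k).P * (row k).Hq := rfl
  have hTc : Tc 1066 = ∑ k ∈ Finset.range 1066, ((row k).Hq : ℝ) := rfl
  have hρ4 : (row 1064).rhoR = ((row 1064).ph'.rho : ℝ) / 2 ^ (row 1064).P := rfl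
  have hρ5 : (row 1065).rhoR = ((row 1065).ph'.rho : ℝ) / 2 ^ (row 1065).P := rfl
  have hT5 : Tc 1065 = Tc 1064 + (row 1064).Hq := Tc_succ 1064
  have hT6 : Tc 1066 = Tc 1065 + (row 1065).Hq := Tc_succ 1065
  have hH4 : (0 : ℝ) < (row 1064).Hq := Hq_pos ((runOK_iff _).mp (runOK_row 1064)).1
  have hH5 : (0 : ℝ) < (row 1065).Hq := Hq_pos ((runOK_iff _).mp (runOK_row 1065)).1
  -- |sD(Tc 1066) − Tc 1066| ≤ S + O
  have hend : |sD (Tc 1066) - Tc 1066| ≤ 1 / 600 + 1 / 700 := by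
    have : |sD (Tc 1066) - 0 - (Tc 1066 - 0)| ≤ _ := hclock
    rw [sub_zero, sub_zero] at this
    rw [hsum] at this
    linarith
  -- row 1065 full, row 1064 full
  have h65 := htime 1065 (by norm_num) (by norm_num) (Tc 1066)
    ⟨by rw [hT6]; linarith, by change Tc 1066 ≤ Tc 1066; exact le_rfl⟩
  have h64 := htime 1064 (by norm_num) (by norm_num) (Tc 1065)
    ⟨by rw [hT5]; linarith, by change Tc 1065 ≤ Tc 1065; exact le_rfl⟩
  have hρH4 : 0 ≤ (row 1064).rhoR * (row 1064).Hq := by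
    have := htime 1064 (by norm_num) (by norm_num) (Tc 1064) ⟨le_rfl, by rw [hT5]; linarith⟩
    exact (abs_nonneg _).trans this
  have hρH5 : 0 ≤ (row 1065).rhoR * (row 1065).Hq := by
    have := htime 1065 (by norm_num) (by norm_num) (Tc 1065) ⟨le_rfl, by rw [hT6]; linarith⟩
    exact (abs_nonneg _).trans this
  rw [hρ4] at h64 hρH4
  rw [hρ5] at h65 hρH5
  have ht2 : t ≤ Tc 1065 + (row 1065).Hq := by have := ht.2; rwa [Tc_succ 1065] at this
  have e1 := abs_le.mp hend
  have e2 := abs_le.mp h65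
  have e3 := abs_le.mp h64
  have e5 := abs_le.mp h19'
  rw [← hTc] at e5
  by_cases htk : t ≤ Tc 1065
  · -- crossing in row 1064
    have hpart := htime 1064 (by norm_num) (by norm_num) t ⟨ht.1, htk⟩
    rw [hρ4] at hpart
    have e4 := abs_le.mp hpart
    rw [abs_le]; constructor <;> linarith [ht.1]
  · -- crossing in row 1065
    have htk' : Tc 1065 < t := lt_of_not_ge htk
    have hpart := htime 1065 (by norm_num) (by norm_num) t ⟨htk'.le, ht.2⟩
    rw [hρ5] at hpart
    have e4 := abs_le.mp hpart
    rw [abs_le]; constructor <;> linarith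


/-- **`I(n) ⇒ I(n+1)` under class-`U` forcing, up to the re-entry certificate.** [folklore] -/
theorem forced_induction_step_of (hre : reentryOK (row 0) reBox = true) {q₀ : Fin 9 → ℝ}
    (hq : ∀ b, |q₀ b - (reBox.cen b : ℝ)| ≤ reBox.rad b) {y δF : ℝ → Fin 9 → ℝ} (hy0 : y 0 = q₀)
    (hsol : ∀ σ, HasDerivAt y (F gK ΛK (y σ) + δF σ) σ) (hδc : Continuous δF)
    (hδ : ∀ σ a, |δF σ a| ≤ (δUQ a : ℝ)) :
    ∃ τ : ℝ, |τ - 19 / 20| ≤ 3 / 500 ∧ 0 < y τ 4 ∧ y τ 5 = (secCert.rho : ℝ) * y τ 4 ∧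
      ((secCert.levLo : ℝ) ≤ y τ 5 / secCert.bmid ∧ y τ 5 / secCert.bmid ≤ secCert.levHi) ∧
      ∀ qm : Fin 4 → ℝ, (∀ m, |qm m - (Q1C m : ℝ)| ≤ Q1W m) →
        ∀ b, |renorm (y τ) qm b - (reBox.cen b : ℝ)| ≤ reBox.rad b := by
  have hp : (row 0).p = 1 := start_readout.1
  have hlock : q₀ (row 0).p = X0 (row 0).p := by
    have h' : |q₀ 1 - (X0Q 1 : ℝ)| ≤ 0 := by simpa [reBox] using hq 1
    rw [hp, X0_eq]
    exact sub_eq_zero.mp (abs_nonpos_iff.mp h')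
  have hbox : ∀ i, |z0 q₀ i| ≤ (row 0).ubR 0 i := fun i =>
    reentry_sound hre (framesOK_row 0) hq i
  obtain ⟨τ, hτ, hsec, h4, hlev, hrd⟩ := forced_section_from hlock hbox hy0 hsol hδc hδ
  exact ⟨τ, hτ, h4, hsec, hlev, fun qm hqm => renorm_mem hsec hrd hqm⟩

/-- **The robust induction step, existence included** (cf. `robust_transfer`). [folklore] -/
theorem robust_induction_step_of (hre : reentryOK (row 0) reBox = true) {δF : ℝ → Fin 9 → ℝ}
    (hδc : Continuous δF) (hδ : ∀ σ a, |δF σ a| ≤ (δUQ a : ℝ)) (q₀ : Fin 9 → ℝ)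
    (hq : ∀ b, |q₀ b - (reBox.cen b : ℝ)| ≤ reBox.rad b) :
    (∃ y : ℝ → Fin 9 → ℝ, y 0 = q₀ ∧ ∀ σ, HasDerivAt y (F gK ΛK (y σ) + δF σ) σ) ∧
    ∀ y : ℝ → Fin 9 → ℝ, y 0 = q₀ → (∀ σ, HasDerivAt y (F gK ΛK (y σ) + δF σ) σ) →
      ∃ τ : ℝ, |τ - 19 / 20| ≤ 3 / 500 ∧ 0 < y τ 4 ∧ y τ 5 = (secCert.rho : ℝ) * y τ 4 ∧
        ((secCert.levLo : ℝ) ≤ y τ 5 / secCert.bmid ∧ y τ 5 / secCert.bmid ≤ secCert.levHi) ∧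
        ∀ qm : Fin 4 → ℝ, (∀ m, |qm m - (Q1C m : ℝ)| ≤ Q1W m) →
          ∀ b, |renorm (y τ) qm b - (reBox.cen b : ℝ)| ≤ reBox.rad b :=
  ⟨CircuitFlow.forced_solution gK ΛK hδc (fun t a => (hδ t a).trans (δUQ_le a)) q₀,
    fun _ hy0 hy => forced_induction_step_of hre hq hy0 hy hδc hδ⟩

end RowChain

end Summit.NavierStokesRegularity.FluidComputer
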